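import Summits.ValiantsHypothesis.ValiantsHypothesis.Theorems.FifoMatchingNNDivisionHardExactPencilInteractionCeiling
import HarnessLib

/-!
# EXACT PENCILS VIII — TOGETHER FACES: the pinning engine at a general two-state block face (`bUn`, `Pins`, `Hpin`, `Wtog = W^β`) (crux `NNDivisionHard`, stmt-ValiantsHypothesis-21181) — `ExactPencil` port part 8/12

Theorems-side port (staged by val-idea-40 g6, C′-census owner per director-valiant R331 (2)(e) / desk #399, for the port hands;
press as `Theorems/FifoMatchingNNDivisionHardExactPencilTogetherFace.lean`, `--kind proof --supports stmt-ValiantsHypothesis-21181 --as helper`; sig-first val-idea-crit-9 g3) of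
§11 of val-idea-38 g2's crux workfile `Cruxes/NNDivisionHard/ExactPencil38.lean` REV 16 @4e81d1716f6b (sha16 d9f2e288279a0b09, 3 456 l., FROZEN — final from 38 g2, bus 01:14:51Z; critic of record val-idea-crit-9 g2/g3: `CRITIC-wave6.md` FINAL + V#97 §2 «rev 14/15 δ KERNEL VERIFIED»).  Declaration texts VERBATIM (namespace
`…Theorems.FifoMatching.ExactPencil`; one-line docstrings added where the source had none); the 40-g5 tools the source RESTATED are
DROPPED here and cited BY NAME from the landed ports `…Theorems.FifoMatching.LocatedRows.*` (✓ p680125 … p683387: `T`, `RowFamily`,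
`hCOR`, `exactTilted`, `ExactPencilLaw`, `pinnedRows`, `unflat`, `three_pow_le_of_block`, `two_pow_half_mul_le`, `zgen`, `cubePt`, …) and
`…Theorems.FifoMatching.XcDivision` (`udRow`, `udPt`, `udInd`, `udMat`, …), so that C′ stays ONE Theorems declaration
`LocatedRows.ExactPencilLaw`.  Part 8/12 of the port (imports part 7, `…Theorems.FifoMatchingNNDivisionHardExactPencilInteractionCeiling`).

* `bUn`, `mem_bUn`, `σ_injective`, `image_inter_bUn`, `ud_block_tog` (`UDISJ_k` at a together face), `Pins`, `Hpin`, ★ `pin_le_star`,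
  ★★ `cube_block_of_pinning`, ★★ `cor_add_cube_bound_of_pinning` (a tight, uniformly pinning direction forces `3^k ≤ (r+1)·2^k`);
* `bsize`, `Wtog` (`W^β`), `Wtog_row_sum`, `Wtog_dotProduct_udPt(_le)`, `Wtog_dotProduct_bUn`, ★ `hCOR_Wtog = 0`, `Wtog_tight`,
  ★★ `cor_add_cube_bound_of_Wtog_pins`.

HONEST LABEL: every theorem here is a DECIDED SPECIES / support lemma for the OPEN law C′ = `LocatedRows.ExactPencilLaw`
(`exactTilted.Law`); the crux 21181 `NNDivisionHard`, C′, `allRows.Law` and COR-VIRTUAL are OPEN; C⁺_entry `LocatedPencilLaw` is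
REFUTED (✓ p679540).  VP ≠ VNP is NOT proved here or anywhere in this tree.
-/

set_option autoImplicit false

-- the mandated summit-side namespace repeats a component by design (single-problem summit)
set_option linter.dupNamespace false

noncomputable section

open Matrix Finset
open scoped Pointwise

namespace Summit.ValiantsHypothesis.ValiantsHypothesis.Theorems.FifoMatching.ExactPencil

open Literature.Barriers.PneNP (HasEFOfSize three_pow_le_card_mul_two_pow_of_cover_univ)
open Literature.Combinatorics.Optimization.FixedSizePsdRank
  (corPolytope flat vecOuter flat_dotProduct_le_of_mem_corPolytope flat_dotProduct_vecOuter)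
open Summit.ValiantsHypothesis.ValiantsHypothesis.Theorems.FifoMatching.XcDivision
  (udRow udPt udInd udMat ud_data udInd_apply udInd_sq dot_le_of_mem_convexHull flat_dotProduct_flat)
open Summit.ValiantsHypothesis.ValiantsHypothesis.Theorems.FifoMatching.LocatedRows
  (T CorVirtualHardN RowFamily corVirtualHardN_of_law flat_le_box entryTilted allRows LocatedPencilLaw
    hCOR le_hCOR exists_eq_hCOR flat_le_hCOR hCOR_le_box exactTilted ExactPencilLaw exactTilted_emb_allRows
    corVirtualHardN_of_exactPencilLaw three_pow_le_of_block two_pow_half_mul_le pinnedRows unflat flat_unflat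
    pinnedRows_emb_exactTilted corVirtualHardN_of_pinnedRowsLaw zgen cubePt dotProduct_cubePt)

/-! ## §11 TOGETHER FACES: the pinning engine at a general two-state block face (kernel of memo §2f)

Blocks `A_i = β⁻¹ i` with representatives `σ`; the together face `F_β = {⋃_{i∈S} A_i}` (`bUn`) is exposed EXACTLY by
`W^β = Σ_i (𝟙_{A_i}𝟙_{A_i}ᵀ − |A_i|·I_{A_i})` with `h_COR(W^β) = 0` (`Wtog_dotProduct_udPt_le`, `Wtog_dotProduct_bUn`, `hCOR_Wtog`); the
representative rows read `(1 − |α'∩S|)²` (`ud_block_tog`); ★★ `cube_block_of_pinning` / `cor_add_cube_bound_of_pinning`: a direction tight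
on `F_β` pinning a cube UNIFORMLY (`Pins`, common maximiser `Hpin`, `pin_le_star`) forces `3^k ≤ (r+1)·2^k` on every EF of `COR(n) + cube`. -/

section TogetherFace

variable {n k : ℕ}

/-- the column vertex `b_S := ⋃_{i ∈ S} A_i`. -/
def bUn (β : Fin n → Fin k) (S : Finset (Fin k)) : Finset (Fin n) := Finset.univ.filter (fun x => β x ∈ S)

/-- `x ∈ bUn β S ↔ β x ∈ S`. -/
theorem mem_bUn (β : Fin n → Fin k) (S : Finset (Fin k)) (x : Fin n) : x ∈ bUn β S ↔ β x ∈ S := by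
  simp [bUn]

/-- a section `σ` of `β` is injective. -/
theorem σ_injective {β : Fin n → Fin k} {σ : Fin k → Fin n} (hβσ : ∀ i, β (σ i) = i) : Function.Injective σ :=
  fun i j h => by rw [← hβσ i, ← hβσ j, h]

/-- `σ(α') ∩ bUn β S = σ(α' ∩ S)` (the UDISJ pattern at a together face). -/
theorem image_inter_bUn {β : Fin n → Fin k} {σ : Fin k → Fin n} (hβσ : ∀ i, β (σ i) = i) (α' S : Finset (Fin k)) :
    α'.image σ ∩ bUn β S = (α' ∩ S).image σ := by
  classical
  ext x
  rw [Finset.mem_inter, Finset.mem_image, Finset.mem_image, mem_bUn]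
  constructor
  · rintro ⟨⟨i, hi, rfl⟩, hx⟩
    rw [hβσ] at hx
    exact ⟨i, Finset.mem_inter.mpr ⟨hi, hx⟩, rfl⟩
  · rintro ⟨i, hi, rfl⟩
    exact ⟨⟨i, (Finset.mem_inter.mp hi).1, rfl⟩, by rw [hβσ]; exact (Finset.mem_inter.mp hi).2⟩

/-- the clique part of the block at a together face: `1 − ⟨udRow σ(α'), x_{b_S}⟩ = (1 − |α' ∩ S|)²`. -/
theorem ud_block_tog {β : Fin n → Fin k} {σ : Fin k → Fin n} (hβσ : ∀ i, β (σ i) = i) (α' S : Finset (Fin k)) :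
    1 - udRow (α'.image σ) ⬝ᵥ udPt (bUn β S) = (1 - ((α' ∩ S).card : ℝ)) ^ 2 := by
  classical
  rw [(ud_data n).2.2.1, image_inter_bUn hβσ, Finset.card_image_of_injective _ (σ_injective hβσ)]

/-! ### uniform pinning and the common maximiser -/

/-- `W` PINS the cube `G` UNIFORMLY: every generator's located score `⟨udRow a + W, G t⟩` has a sign independent of the row `a`. -/
def Pins (W : Matrix (Fin n) (Fin n) ℝ) {N : ℕ} (G : Fin N → Matrix (Fin n) (Fin n) ℝ) : Prop :=
  ∀ t, (∀ a : Finset (Fin n), 0 ≤ (udRow a + flat W) ⬝ᵥ flat (G t)) ∨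
    (∀ a : Finset (Fin n), (udRow a + flat W) ⬝ᵥ flat (G t) ≤ 0)

/-- the common maximiser: the nonnegatively pinned generators. -/
noncomputable def Hpin (W : Matrix (Fin n) (Fin n) ℝ) {N : ℕ} (G : Fin N → Matrix (Fin n) (Fin n) ℝ) : Finset (Fin N) :=
  Finset.univ.filter (fun t => ∀ a : Finset (Fin n), 0 ≤ (udRow a + flat W) ⬝ᵥ flat (G t))

/-- membership in `Hpin W G`: the generator's score is `≥ 0` for EVERY clique row. -/
theorem mem_Hpin (W : Matrix (Fin n) (Fin n) ℝ) {N : ℕ} (G : Fin N → Matrix (Fin n) (Fin n) ℝ) (t : Fin N) :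
    t ∈ Hpin W G ↔ ∀ a : Finset (Fin n), 0 ≤ (udRow a + flat W) ⬝ᵥ flat (G t) := by
  simp [Hpin]

/-- ★ under uniform pinning `Hpin` maximises EVERY located row over the cube. -/
theorem pin_le_star {W : Matrix (Fin n) (Fin n) ℝ} {N : ℕ} {G : Fin N → Matrix (Fin n) (Fin n) ℝ} (hp : Pins W G)
    (Q₀ : Matrix (Fin n) (Fin n) ℝ) (a : Finset (Fin n)) (P : Finset (Fin N)) :
    (udRow a + flat W) ⬝ᵥ cubePt Q₀ G P ≤ (udRow a + flat W) ⬝ᵥ cubePt Q₀ G (Hpin W G) := by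
  classical
  set ρ := udRow a + flat W
  rw [dotProduct_cubePt, dotProduct_cubePt]
  have hsplit := Finset.sum_filter_add_sum_filter_not P (fun t => t ∈ Hpin W G) (fun t => ρ ⬝ᵥ flat (G t))
  have hneg : ∑ t ∈ P.filter (fun t => t ∉ Hpin W G), ρ ⬝ᵥ flat (G t) ≤ 0 := by
    refine Finset.sum_nonpos fun t ht => ?_
    have ht' : t ∉ Hpin W G := (Finset.mem_filter.mp ht).2
    rcases hp t with h | h
    · exact absurd ((mem_Hpin W G t).mpr h) ht'
    · exact h a
  have hsub : P.filter (fun t => t ∈ Hpin W G) ⊆ Hpin W G := fun t ht => (Finset.mem_filter.mp ht).2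
  have hmono : ∑ t ∈ P.filter (fun t => t ∈ Hpin W G), ρ ⬝ᵥ flat (G t) ≤ ∑ t ∈ Hpin W G, ρ ⬝ᵥ flat (G t) :=
    Finset.sum_le_sum_of_subset_of_nonneg hsub fun t ht _ => (mem_Hpin W G t).mp ht a
  linarith

/-! ### ★★ the engine: a tight, uniformly pinning direction at a together face forces `UDISJ_k` -/

/-- ★★ **PINNING ENGINE AT A TOGETHER FACE** (listed-passenger currency, budget-free): `3^k ≤ (r+1)·2^k`. -/
theorem cube_block_of_pinning {β : Fin n → Fin k} {σ : Fin k → Fin n} (hβσ : ∀ i, β (σ i) = i)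
    {N K : ℕ} (Q₀ : Matrix (Fin n) (Fin n) ℝ) (G : Fin N → Matrix (Fin n) (Fin n) ℝ) (W : Matrix (Fin n) (Fin n) ℝ)
    (htight : ∀ S : Finset (Fin k), flat W ⬝ᵥ udPt (bUn β S) = hCOR W) (hp : Pins W G)
    (e : Fin (K + 1) → Finset (Fin N)) (he : Function.Surjective e) (r : ℕ)
    (mm : exactTilted.A n → ℝ) (hle : ∀ a j, exactTilted.ρ n a ⬝ᵥ (cubePt Q₀ G ∘ e) j ≤ mm a)
    (hat : ∀ a, ∃ j, exactTilted.ρ n a ⬝ᵥ (cubePt Q₀ G ∘ e) j = mm a)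
    (U : exactTilted.A n → Option (Fin r) → ℝ) (V : Finset (Fin n) × Fin (K + 1) → Option (Fin r) → ℝ)
    (hU : ∀ a i, 0 ≤ U a i) (hV : ∀ p i, 0 ≤ V p i)
    (hfac : ∀ a b j, (exactTilted.β n a + mm a) - exactTilted.ρ n a ⬝ᵥ (udPt b + (cubePt Q₀ G ∘ e) j) = ∑ i, U a i * V (b, j) i) :
    3 ^ k ≤ (r + 1) * 2 ^ k := by
  classical
  obtain ⟨jstar, hj⟩ := he (Hpin W G)
  let row : Finset (Fin k) → exactTilted.A n := fun α' => (α'.image σ, W)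
  let col : Finset (Fin k) → Finset (Fin n) × Fin (K + 1) := fun S => (bUn β S, jstar)
  have hq : (cubePt Q₀ G ∘ e) jstar = cubePt Q₀ G (Hpin W G) := by simp [hj]
  have hmm : ∀ α', mm (row α') = (udRow (α'.image σ) + flat W) ⬝ᵥ cubePt Q₀ G (Hpin W G) := by
    intro α'
    obtain ⟨j₀, hj₀⟩ := hat (row α')
    have h1 := hle (row α') jstar
    rw [hq] at h1
    have h2 : exactTilted.ρ n (row α') ⬝ᵥ (cubePt Q₀ G ∘ e) j₀ ≤ (udRow (α'.image σ) + flat W) ⬝ᵥ cubePt Q₀ G (Hpin W G) :=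
      pin_le_star hp Q₀ _ (e j₀)
    rw [hj₀] at h2
    exact le_antisymm h2 h1
  have key := three_pow_le_of_block (ι := Option (Fin r)) U V hU hV row col ?_
  · simpa [Fintype.card_option, Fintype.card_fin] using key
  · intro α' S
    rw [← hfac (row α') (bUn β S) jstar, hq, hmm α']
    show ((1 + hCOR W) + (udRow (α'.image σ) + flat W) ⬝ᵥ cubePt Q₀ G (Hpin W G)) -
        (udRow (α'.image σ) + flat W) ⬝ᵥ (udPt (bUn β S) + cubePt Q₀ G (Hpin W G)) = (1 - ((α' ∩ S).card : ℝ)) ^ 2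
    rw [dotProduct_add, add_dotProduct _ _ (udPt (bUn β S)), htight S, ← ud_block_tog hβσ α' S]
    ring

/-- ★★ **TOP LAW, budget-free**: if some direction is tight on the together face of `β` and pins the cube uniformly, then every EF of
`COR(n) + cube` has size `r` with `3^k ≤ (r+1)·2^k`. -/
theorem cor_add_cube_bound_of_pinning {β : Fin n → Fin k} {σ : Fin k → Fin n} (hβσ : ∀ i, β (σ i) = i)
    {N : ℕ} (Q₀ : Matrix (Fin n) (Fin n) ℝ) (G : Fin N → Matrix (Fin n) (Fin n) ℝ) (W : Matrix (Fin n) (Fin n) ℝ)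
    (htight : ∀ S : Finset (Fin k), flat W ⬝ᵥ udPt (bUn β S) = hCOR W) (hp : Pins W G) (r : ℕ)
    (hEF : HasEFOfSize (corPolytope n + convexHull ℝ (Set.range (cubePt Q₀ G))) r) :
    3 ^ k ≤ (r + 1) * 2 ^ k := by
  classical
  obtain ⟨pt_mem, -, -, -⟩ := ud_data n
  let mm : exactTilted.A n → ℝ := fun a =>
    Finset.univ.sup' Finset.univ_nonempty (fun P : Finset (Fin N) => exactTilted.ρ n a ⬝ᵥ cubePt Q₀ G P)
  have hat : ∀ a, ∃ P, exactTilted.ρ n a ⬝ᵥ cubePt Q₀ G P = mm a := fun a => by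
    obtain ⟨P, -, hP⟩ := Finset.exists_mem_eq_sup' Finset.univ_nonempty
      (fun P : Finset (Fin N) => exactTilted.ρ n a ⬝ᵥ cubePt Q₀ G P)
    exact ⟨P, hP.symm⟩
  have hle : ∀ a P, exactTilted.ρ n a ⬝ᵥ cubePt Q₀ G P ≤ mm a := fun a P =>
    Finset.le_sup' (fun P : Finset (Fin N) => exactTilted.ρ n a ⬝ᵥ cubePt Q₀ G P) (Finset.mem_univ P)
  have hm : ∀ a, ∀ y ∈ convexHull ℝ (Set.range (cubePt Q₀ G)), exactTilted.ρ n a ⬝ᵥ y ≤ mm a := fun a =>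
    dot_le_of_mem_convexHull _ _ _ (by rintro _ ⟨P, rfl⟩; exact hle a P)
  have hq : ∀ P : Finset (Fin N), cubePt Q₀ G P ∈ convexHull ℝ (Set.range (cubePt Q₀ G)) :=
    fun P => subset_convexHull ℝ _ ⟨P, rfl⟩
  have hv : ∀ p : Finset (Fin n) × Finset (Fin N),
      udPt p.1 + cubePt Q₀ G p.2 ∈ corPolytope n + convexHull ℝ (Set.range (cubePt Q₀ G)) :=
    fun p => Set.add_mem_add (pt_mem p.1) (hq p.2)
  have hvalid : ∀ a, ∀ x ∈ corPolytope n + convexHull ℝ (Set.range (cubePt Q₀ G)),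
      exactTilted.ρ n a ⬝ᵥ x ≤ exactTilted.β n a + mm a := by
    rintro a x ⟨p, hp, y, hy, rfl⟩
    rw [dotProduct_add]
    exact add_le_add (exactTilted.valid n a p hp) (hm a y hy)
  obtain ⟨U, V, hU, hV, hfac⟩ := Literature.Barriers.PneNP.HasEFOfSize.exists_nonneg_factorization hEF
    (fun p : Finset (Fin n) × Finset (Fin N) => udPt p.1 + cubePt Q₀ G p.2) hv (exactTilted.ρ n)
    (fun a => exactTilted.β n a + mm a) hvalid
  -- list the cube by the identity listing of `Finset (Fin N)` through an equivalence with `Fin (K+1)`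
  obtain ⟨K, eqv⟩ : ∃ K, Nonempty (Fin (K + 1) ≃ Finset (Fin N)) := by
    refine ⟨Fintype.card (Finset (Fin N)) - 1, ⟨(Fintype.equivFinOfCardEq ?_).symm⟩⟩
    have : 0 < Fintype.card (Finset (Fin N)) := Fintype.card_pos
    omega
  obtain ⟨eK⟩ := eqv
  exact cube_block_of_pinning hβσ Q₀ G W htight hp eK eK.surjective r mm
    (fun a j => hle a (eK j)) (fun a => by obtain ⟨P, hP⟩ := hat a; exact ⟨eK.symm P, by simpa using hP⟩)
    U (fun p i => V (p.1, eK p.2) i) hU (fun p i => hV _ i) (fun a b j => hfac a (b, eK j))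

/-! ### the together-face direction `W^β` itself (the face exists; `h_COR = 0`) -/

/-- block sizes `|A_i|`. -/
def bsize (β : Fin n → Fin k) (i : Fin k) : ℕ := (Finset.univ.filter (fun y => β y = i)).card

/-- `W^β := Σ_i (𝟙_{A_i}𝟙_{A_i}ᵀ − |A_i|·I_{A_i})`. -/
def Wtog (β : Fin n → Fin k) : Matrix (Fin n) (Fin n) ℝ := fun x y =>
  (if β y = β x then (1 : ℝ) else 0) - (if y = x then (bsize β (β x) : ℝ) else 0)

/-- row sums of `W^β` over a vertex `b`: `|b ∩ block(x)| − |block(x)|` for `x ∈ b`. -/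
theorem Wtog_row_sum (β : Fin n → Fin k) (b : Finset (Fin n)) {x : Fin n} (hx : x ∈ b) :
    ∑ y ∈ b, Wtog β x y = ((b.filter (fun y => β y = β x)).card : ℝ) - (bsize β (β x) : ℝ) := by
  classical
  unfold Wtog
  rw [Finset.sum_sub_distrib, Finset.sum_boole, Finset.sum_ite_eq' b x, if_pos hx]

/-- `⟨W^β, x_b⟩ = Σ_{x∈b} (|b ∩ block(x)| − |block(x)|)`. -/
theorem Wtog_dotProduct_udPt (β : Fin n → Fin k) (b : Finset (Fin n)) :
    flat (Wtog β) ⬝ᵥ udPt b = ∑ x ∈ b, (((b.filter (fun y => β y = β x)).card : ℝ) - (bsize β (β x) : ℝ)) := by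
  rw [flat_dotProduct_udPt_sum]
  exact Finset.sum_congr rfl fun x hx => Wtog_row_sum β b hx

/-- `⟨W^β, x_b⟩ = Σ_{x∈b} (|b ∩ A_{β x}| − |A_{β x}|) ≤ 0`. -/
theorem Wtog_dotProduct_udPt_le (β : Fin n → Fin k) (b : Finset (Fin n)) : flat (Wtog β) ⬝ᵥ udPt b ≤ 0 := by
  classical
  rw [Wtog_dotProduct_udPt]
  refine Finset.sum_nonpos fun x _ => ?_
  have : (b.filter (fun y => β y = β x)).card ≤ bsize β (β x) :=
    Finset.card_le_card (fun y hy => by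
      rw [Finset.mem_filter] at hy ⊢
      exact ⟨Finset.mem_univ y, hy.2⟩)
  have h' : ((b.filter (fun y => β y = β x)).card : ℝ) ≤ (bsize β (β x) : ℝ) := by exact_mod_cast this
  linarith

/-- `= 0` on every union of blocks `b_S`. -/
theorem Wtog_dotProduct_bUn (β : Fin n → Fin k) (S : Finset (Fin k)) : flat (Wtog β) ⬝ᵥ udPt (bUn β S) = 0 := by
  classical
  rw [Wtog_dotProduct_udPt]
  refine Finset.sum_eq_zero fun x hx => ?_
  have hS : β x ∈ S := (mem_bUn β S x).mp hx
  have : (bUn β S).filter (fun y => β y = β x) = Finset.univ.filter (fun y => β y = β x) := by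
    ext y
    simp only [Finset.mem_filter, Finset.mem_univ, true_and, mem_bUn]
    constructor
    · exact fun h => h.2
    · intro h; exact ⟨h ▸ hS, h⟩
  rw [this]
  show ((Finset.univ.filter (fun y => β y = β x)).card : ℝ) - (bsize β (β x) : ℝ) = 0
  simp [bsize]

/-- ★ the together face is EXACTLY exposed with support value `0`: `h_COR(W^β) = 0`, attained on every `b_S`. -/
theorem hCOR_Wtog (β : Fin n → Fin k) : hCOR (Wtog β) = 0 :=
  le_antisymm (Finset.sup'_le _ _ fun b _ => Wtog_dotProduct_udPt_le β b)
    (by have h := le_hCOR (Wtog β) (bUn β ∅); rwa [Wtog_dotProduct_bUn] at h)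

/-- `W^β` attains its exact rhs `h_COR(W^β)` on every together-face vertex `bUn β S`. -/
theorem Wtog_tight (β : Fin n → Fin k) (S : Finset (Fin k)) : flat (Wtog β) ⬝ᵥ udPt (bUn β S) = hCOR (Wtog β) := by
  rw [hCOR_Wtog, Wtog_dotProduct_bUn]

/-- COROLLARY: a cube PINNED UNIFORMLY BY `W^β` ITSELF is decided with `3^k ≤ (r+1)·2^k` (no extra tilt needed). -/
theorem cor_add_cube_bound_of_Wtog_pins {β : Fin n → Fin k} {σ : Fin k → Fin n} (hβσ : ∀ i, β (σ i) = i)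
    {N : ℕ} (Q₀ : Matrix (Fin n) (Fin n) ℝ) (G : Fin N → Matrix (Fin n) (Fin n) ℝ) (hp : Pins (Wtog β) G) (r : ℕ)
    (hEF : HasEFOfSize (corPolytope n + convexHull ℝ (Set.range (cubePt Q₀ G))) r) :
    3 ^ k ≤ (r + 1) * 2 ^ k :=
  cor_add_cube_bound_of_pinning hβσ Q₀ G (Wtog β) (Wtog_tight β) hp r hEF

end TogetherFace

end Summit.ValiantsHypothesis.ValiantsHypothesis.Theorems.FifoMatching.ExactPencil
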